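import Literature.Analysis.FluidPDE.AxisymNoSwirlImpulseSlice
import Mathlib.Analysis.SpecialFunctions.JapaneseBracket
import HarnessLib

/-!
# Axisymmetric flows without swirl: the impulse cut-off weights `g_ε = (1 + ε|x|²)⁻²`
# (step of Gallay–Šverák 2015, Lemma 6.4)

Analysis/FluidPDE file on the discharge path of the named fact
`Literature.Analysis.FluidPDE.GallaySverak2015.ImpulseConservation`
(`AxisymNoSwirlScaleInvariantBounds.lean`; Th. Gallay, V. Šverák, Confluentes Math. 7 (2015)
67–92 = arXiv:1510.01036, §6 Lemma 6.4: conservation of the impulse `∫ r²ω_θ dr dz`).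

The printed proof tests the `η`-equation against the unbounded weight `r²`.  In the tree's smooth
class the weighted slice identity `IsTaoSolutionOn.integral_weight_mul_angVortQuot_deriv_eq`
(`AxisymNoSwirlImpulseSlice`) and the time balance
`IsTaoSolutionOn.integral_weight_mul_angVortQuot_eq_add` (`AxisymNoSwirlImpulseBalance`) are
applied to the bounded weights `r² g_ε`,

`g_ε(x) = impulseWeight ε x = ((1 + ε|x|²)²)⁻¹`, `0 ≤ ε`,

and `ε → 0`.  This file supplies the calculus of this family: smoothness, the gradient
`∇g_ε = −4ε(1 + ε|x|²)⁻³ x`, the closed form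
`div (r²∇g_ε) = −4ε r²(5 − ε|x|²)(1 + ε|x|²)⁻⁴`, the uniform bounds
`|div (r²∇g_ε)| ≤ 20`, `|r² Dg_ε[w]| ≤ 4 r ‖w‖` (dominated convergence) together with the
`O(ε)` forms (pointwise limits), monotonicity in `ε`, and the square integrability of
`r²g_ε`, `xᵢg_ε`, `r²∂ᵢg_ε`, `div (r²∇g_ε)` for `ε > 0` (the hypotheses of the slice identity).

## References

* Th. Gallay, V. Šverák, Confluentes Math. 7 (2015) 67–92, arXiv:1510.01036, §6 Lemma 6.4
  (arXiv p. 19). [`GallaySverak2016`]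
-/

noncomputable section

open MeasureTheory Set Function Filter InnerProductSpace
open _root_.Topology
open scoped NNReal ENNReal RealInnerProductSpace

namespace Literature.Analysis.FluidPDE

/-- Local notation for physical space `ℝ³ = EuclideanSpace ℝ (Fin 3)`. -/
local notation "ℝ³" => EuclideanSpace ℝ (Fin 3)

/-! ### The weights -/

/-- **The impulse cut-off weight** `g_ε(x) = 1 / (1 + ε|x|²)²` (`g_0 = 1`, `0 < g_ε ≤ 1` and
`g_ε ↑ 1` as `ε ↓ 0`; for `ε > 0`, `r²g_ε ∈ L²(ℝ³)`), used to approximate the weight `r²` of the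
impulse `∫ r²η dx` by the square-integrable weights `r²g_ε`. [cite: GallaySverak2016, §6 proof of Lemma 6.4 (arXiv p. 19)] -/
def impulseWeight (ε : ℝ) (x : ℝ³) : ℝ := 1 / (1 + ε * ‖x‖ ^ 2) ^ 2

section Elementary

variable {ε : ℝ}

/-- Unfolding of `impulseWeight`. [cite: GallaySverak2016, §6 proof of Lemma 6.4 (arXiv p. 19); formalization step] -/
theorem impulseWeight_def (ε : ℝ) (x : ℝ³) :
    impulseWeight ε x = 1 / (1 + ε * ‖x‖ ^ 2) ^ 2 := rfl

/-- `1 ≤ 1 + ε|x|²` for `0 ≤ ε`. [cite: GallaySverak2016, §6 proof of Lemma 6.4 (arXiv p. 19); formalization step] -/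
theorem one_le_impulseBase (hε : 0 ≤ ε) (x : ℝ³) : 1 ≤ 1 + ε * ‖x‖ ^ 2 :=
  le_add_of_nonneg_right (by positivity)

/-- `0 < 1 + ε|x|²` for `0 ≤ ε`. [cite: GallaySverak2016, §6 proof of Lemma 6.4 (arXiv p. 19); formalization step] -/
theorem impulseBase_pos (hε : 0 ≤ ε) (x : ℝ³) : 0 < 1 + ε * ‖x‖ ^ 2 :=
  one_pos.trans_le (one_le_impulseBase hε x)

/-- `g_0 = 1`. [cite: GallaySverak2016, §6 proof of Lemma 6.4 (arXiv p. 19); formalization step] -/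
@[simp] theorem impulseWeight_zero_left (x : ℝ³) : impulseWeight 0 x = 1 := by
  simp [impulseWeight]

/-- `0 < g_ε`. [cite: GallaySverak2016, §6 proof of Lemma 6.4 (arXiv p. 19); formalization step] -/
theorem impulseWeight_pos (hε : 0 ≤ ε) (x : ℝ³) : 0 < impulseWeight ε x :=
  one_div_pos.2 (pow_pos (impulseBase_pos hε x) 2)

/-- `g_ε ≤ 1`. [cite: GallaySverak2016, §6 proof of Lemma 6.4 (arXiv p. 19); formalization step] -/
theorem impulseWeight_le_one (hε : 0 ≤ ε) (x : ℝ³) : impulseWeight ε x ≤ 1 :=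
  (div_le_one (pow_pos (impulseBase_pos hε x) 2)).2 (one_le_pow₀ (one_le_impulseBase hε x))

/-- `g_ε ≤ 1 / (1 + ε|x|²)`. [cite: GallaySverak2016, §6 proof of Lemma 6.4 (arXiv p. 19); formalization step] -/
theorem impulseWeight_le_one_div (hε : 0 ≤ ε) (x : ℝ³) :
    impulseWeight ε x ≤ 1 / (1 + ε * ‖x‖ ^ 2) :=
  one_div_le_one_div_of_le (impulseBase_pos hε x)
    (le_self_pow₀ (one_le_impulseBase hε x) two_ne_zero)

/-- Monotonicity in `ε`: `0 ≤ ε ≤ ε' ⇒ g_{ε'} ≤ g_ε` (so `g_ε ↑` as `ε ↓ 0`). [cite: GallaySverak2016, §6 proof of Lemma 6.4 (arXiv p. 19); formalization step] -/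
theorem impulseWeight_antitone (hε : 0 ≤ ε) {ε' : ℝ} (hle : ε ≤ ε') (x : ℝ³) :
    impulseWeight ε' x ≤ impulseWeight ε x := by
  have h1 : 1 + ε * ‖x‖ ^ 2 ≤ 1 + ε' * ‖x‖ ^ 2 := by gcongr
  exact one_div_le_one_div_of_le (pow_pos (impulseBase_pos hε x) 2)
    (pow_le_pow_left₀ (impulseBase_pos hε x).le h1 2)

/-- The limit `g_ε(x) → 1` as `ε → 0`. [cite: GallaySverak2016, §6 proof of Lemma 6.4 (arXiv p. 19); formalization step] -/
theorem tendsto_impulseWeight_nhds_zero (x : ℝ³) :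
    Tendsto (fun ε => impulseWeight ε x) (𝓝 0) (𝓝 1) := by
  have hc : ContinuousAt (fun ε : ℝ => 1 / (1 + ε * ‖x‖ ^ 2) ^ 2) 0 := by
    refine continuousAt_const.div
      ((continuous_const.add (continuous_id.mul continuous_const)).pow 2).continuousAt ?_
    norm_num
  have := hc.tendsto
  simp only [zero_mul, add_zero, one_pow, div_one] at this
  exact this

/-- `r² ≤ |x|²`. [cite: GallaySverak2016, §6 proof of Lemma 6.4 (arXiv p. 19); formalization step] -/
theorem cylRadius_sq_le_norm_sq (x : ℝ³) : cylRadius x ^ 2 ≤ ‖x‖ ^ 2 := by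
  rw [cylRadius_sq, EuclideanSpace.norm_sq_eq, Fin.sum_univ_three]
  simp only [Real.norm_eq_abs, sq_abs]
  nlinarith [sq_nonneg (x 2)]

/-- `r ≤ |x|` (private copy of the tree's `cylRadius_le_norm` of
`PeriodicCylinderFrameInversion`, not imported here). [folklore] -/
private theorem cylRadius_le_norm' (x : ℝ³) : cylRadius x ≤ ‖x‖ :=
  (pow_le_pow_iff_left₀ (cylRadius_nonneg x) (norm_nonneg x) two_ne_zero).1
    (cylRadius_sq_le_norm_sq x)

end Elementary

/-! ### Differential calculus of `g_ε` -/

section Calculus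

variable {ε : ℝ}

/-- The base `1 + ε|x|²` has derivative `ε • (2 • ⟪x, ·⟫)`. [cite: GallaySverak2016, §6 proof of Lemma 6.4 (arXiv p. 19); formalization step] -/
theorem hasFDerivAt_impulseBase (ε : ℝ) (x : ℝ³) :
    HasFDerivAt (fun y : ℝ³ => 1 + ε * ‖y‖ ^ 2) (ε • ((2 : ℕ) • innerSL ℝ x)) x :=
  ((hasStrictFDerivAt_norm_sq x).hasFDerivAt.const_mul ε).const_add 1

/-- Evaluation of the base derivative: `D(1 + ε|x|²)(x)[w] = 2ε⟪x, w⟫`. [cite: GallaySverak2016, §6 proof of Lemma 6.4 (arXiv p. 19); formalization step] -/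
theorem impulseBase_fderiv_apply (ε : ℝ) (x w : ℝ³) :
    (ε • ((2 : ℕ) • innerSL ℝ x) : ℝ³ →L[ℝ] ℝ) w = 2 * ε * ⟪x, w⟫ := by
  rw [_root_.smul_apply, _root_.smul_apply, innerSL_apply_apply, nsmul_eq_mul, smul_eq_mul]
  push_cast
  ring

/-- `D(1 + ε|x|²)(x)[x] = 2ε|x|²`. [cite: GallaySverak2016, §6 proof of Lemma 6.4 (arXiv p. 19); formalization step] -/
theorem impulseBase_fderiv_apply_self (ε : ℝ) (x : ℝ³) :
    (ε • ((2 : ℕ) • innerSL ℝ x) : ℝ³ →L[ℝ] ℝ) x = 2 * ε * ‖x‖ ^ 2 := by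
  rw [impulseBase_fderiv_apply, real_inner_self_eq_norm_sq]

/-- `g_ε ∈ C^n` for `0 ≤ ε`. [cite: GallaySverak2016, §6 proof of Lemma 6.4 (arXiv p. 19); formalization step] -/
theorem contDiff_impulseWeight (hε : 0 ≤ ε) {n : ℕ∞} : ContDiff ℝ n (impulseWeight ε) := by
  have hb : ContDiff ℝ n fun y : ℝ³ => 1 + ε * ‖y‖ ^ 2 :=
    contDiff_const.add (contDiff_const.mul (contDiff_norm_sq ℝ))
  exact contDiff_const.div (hb.pow 2) fun x => (pow_pos (impulseBase_pos hε x) 2).ne'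

/-- Continuity of `g_ε`. [cite: GallaySverak2016, §6 proof of Lemma 6.4 (arXiv p. 19); formalization step] -/
theorem continuous_impulseWeight (hε : 0 ≤ ε) : Continuous (impulseWeight ε) :=
  (contDiff_impulseWeight hε (n := 0)).continuous

/-- **The derivative of `g_ε`**: `Dg_ε(x)[w] = −4ε⟪x, w⟫ / (1 + ε|x|²)³`. [cite: GallaySverak2016, §6 proof of Lemma 6.4 (arXiv p. 19); formalization step] -/
theorem fderiv_impulseWeight_apply (hε : 0 ≤ ε) (x w : ℝ³) :
    fderiv ℝ (impulseWeight ε) x w = -(4 * ε) * ⟪x, w⟫ / (1 + ε * ‖x‖ ^ 2) ^ 3 := by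
  have hb := hasFDerivAt_impulseBase ε x
  have hb0 : (1 + ε * ‖x‖ ^ 2) ≠ 0 := (impulseBase_pos hε x).ne'
  -- `g_ε = (s ↦ 1/s²) ∘ (1 + ε|·|²)`
  have hk : HasDerivAt (fun s : ℝ => 1 / s ^ 2)
      ((0 * (1 + ε * ‖x‖ ^ 2) ^ 2 - 1 * (↑(2 : ℕ) * (1 + ε * ‖x‖ ^ 2) ^ (2 - 1))) /
        ((1 + ε * ‖x‖ ^ 2) ^ 2) ^ 2) (1 + ε * ‖x‖ ^ 2) :=
    (hasDerivAt_const _ (1 : ℝ)).fun_div (hasDerivAt_pow 2 _) (pow_ne_zero 2 hb0)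
  have h0 := hk.comp_hasFDerivAt x hb
  have h : HasFDerivAt (impulseWeight ε) _ x := h0
  rw [h.fderiv, _root_.smul_apply, impulseBase_fderiv_apply, smul_eq_mul]
  push_cast
  field_simp
  ring

/-- **The gradient of `g_ε`**: `∇g_ε(x) = (−4ε / (1 + ε|x|²)³) x`. [cite: GallaySverak2016, §6 proof of Lemma 6.4 (arXiv p. 19); formalization step] -/
theorem gradient_impulseWeight (hε : 0 ≤ ε) (x : ℝ³) :
    gradient (impulseWeight ε) x = (-(4 * ε) / (1 + ε * ‖x‖ ^ 2) ^ 3) • x := by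
  refine ext_inner_right ℝ fun w => ?_
  rw [gradient, InnerProductSpace.toDual_symm_apply, fderiv_impulseWeight_apply hε, real_inner_smul_left]
  ring

/-- The radial coefficient of `r²∇g_ε`: `s_ε(x) = r² · (−4ε)/(1 + ε|x|²)³`. [folklore] -/
private def sCoeff (ε : ℝ) (x : ℝ³) : ℝ := cylRadius x ^ 2 * (-(4 * ε) / (1 + ε * ‖x‖ ^ 2) ^ 3)

/-- `r²∇g_ε = s_ε • id`. [folklore] -/
private theorem rsq_smul_gradient_eq (hε : 0 ≤ ε) :
    (fun y : ℝ³ => (cylRadius y ^ 2) • gradient (impulseWeight ε) y) = fun y => sCoeff ε y • y := by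
  funext y
  rw [gradient_impulseWeight hε, smul_smul]
  rfl

/-- Evaluation of the coordinate projections (definitional). [folklore] -/
private theorem proj_apply₃ (i : Fin 3) (x : ℝ³) :
    (EuclideanSpace.proj i : ℝ³ →L[ℝ] ℝ) x = x i := rfl

/-- `div (y ↦ y) = 3` on `ℝ³`. [folklore] -/
private theorem divergence_id_three' (y : ℝ³) :
    VectorCalculus.divergence (fun x : ℝ³ => x) y = 3 := by
  rw [VectorCalculus.divergence, fderiv_fun_id]
  have := LinearMap.trace_id ℝ ℝ³
  rw [finrank_euclideanSpace_fin] at this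
  exact_mod_cast this

/-- **The divergence of `r²∇g_ε` in closed form**:
`div (r²∇g_ε)(x) = −4ε r² (5 − ε|x|²) / (1 + ε|x|²)⁴`. [cite: GallaySverak2016, §6 proof of Lemma 6.4 (arXiv p. 19)] -/
theorem divergence_rsq_gradient_impulseWeight (hε : 0 ≤ ε) (x : ℝ³) :
    VectorCalculus.divergence (fun y : ℝ³ => (cylRadius y ^ 2) • gradient (impulseWeight ε) y) x =
      -(4 * ε) * cylRadius x ^ 2 * (5 - ε * ‖x‖ ^ 2) / (1 + ε * ‖x‖ ^ 2) ^ 4 := by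
  rw [rsq_smul_gradient_eq hε]
  have hb := hasFDerivAt_impulseBase ε x
  have hb0 : (1 + ε * ‖x‖ ^ 2) ≠ 0 := (impulseBase_pos hε x).ne'
  -- the coefficient `c_ε = (s ↦ -4ε/s³) ∘ (1 + ε|·|²)`
  have hk : HasDerivAt (fun s : ℝ => -(4 * ε) / s ^ 3)
      ((0 * (1 + ε * ‖x‖ ^ 2) ^ 3 - -(4 * ε) * (↑(3 : ℕ) * (1 + ε * ‖x‖ ^ 2) ^ (3 - 1))) /
        ((1 + ε * ‖x‖ ^ 2) ^ 3) ^ 2) (1 + ε * ‖x‖ ^ 2) :=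
    (hasDerivAt_const _ (-(4 * ε))).fun_div (hasDerivAt_pow 3 _) (pow_ne_zero 3 hb0)
  have hc0 := hk.comp_hasFDerivAt x hb
  have hc : HasFDerivAt (fun y : ℝ³ => -(4 * ε) / (1 + ε * ‖y‖ ^ 2) ^ 3) _ x := hc0
  have hr := hasFDerivAt_cylRadius_sq x
  have hs : HasFDerivAt (sCoeff ε) _ x := hr.mul hc
  rw [divergence_smul_apply hs.differentiableAt differentiableAt_fun_id, divergence_id_three',
    real_inner_comm, gradient, InnerProductSpace.toDual_symm_apply, hs.fderiv]
  simp only [_root_.add_apply, _root_.smul_apply, smul_eq_mul, innerSL_apply_apply,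
    real_inner_self_eq_norm_sq, proj_apply₃, sCoeff]
  push_cast
  rw [cylRadius_sq]
  field_simp
  ring

/-- `div (r²∇g_ε)` is continuous. [cite: GallaySverak2016, §6 proof of Lemma 6.4 (arXiv p. 19); formalization step] -/
theorem continuous_divergence_rsq_gradient_impulseWeight (hε : 0 ≤ ε) :
    Continuous fun x => VectorCalculus.divergence
      (fun y : ℝ³ => (cylRadius y ^ 2) • gradient (impulseWeight ε) y) x := by
  simp_rw [divergence_rsq_gradient_impulseWeight hε]
  have hb : Continuous fun x : ℝ³ => 1 + ε * ‖x‖ ^ 2 := by fun_prop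
  refine Continuous.div ?_ (hb.pow 4) fun x => pow_ne_zero 4 (impulseBase_pos hε x).ne'
  exact (continuous_const.mul (continuous_cylRadius.pow 2)).mul
    (continuous_const.sub (continuous_const.mul (continuous_norm.pow 2)))

end Calculus

/-! ### Uniform bounds and `O(ε)` forms -/

section Bounds

variable {ε : ℝ}

/-- **`|div (r²∇g_ε)| ≤ 20 / (1 + ε|x|²)²`** (`εr² ≤ 1 + ε|x|²`, `5 + ε|x|² ≤ 5(1 + ε|x|²)`).
[cite: GallaySverak2016, §6 proof of Lemma 6.4 (arXiv p. 19); formalization step] -/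
theorem abs_divergence_rsq_gradient_impulseWeight_le_div (hε : 0 ≤ ε) (x : ℝ³) :
    |VectorCalculus.divergence (fun y : ℝ³ => (cylRadius y ^ 2) • gradient (impulseWeight ε) y) x|
      ≤ 20 / (1 + ε * ‖x‖ ^ 2) ^ 2 := by
  rw [divergence_rsq_gradient_impulseWeight hε]
  have hb := impulseBase_pos hε x
  have hr := cylRadius_sq_le_norm_sq x
  have hr0 := sq_nonneg (cylRadius x)
  rw [abs_div, abs_of_pos (pow_pos hb 4), div_le_div_iff₀ (pow_pos hb 4) (pow_pos hb 2)]
  have h5 : |5 - ε * ‖x‖ ^ 2| ≤ 5 + ε * ‖x‖ ^ 2 :=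
    (abs_sub _ _).trans (by rw [abs_of_nonneg (by norm_num : (0:ℝ) ≤ 5),
      abs_of_nonneg (by positivity)])
  have h1 : |-(4 * ε) * cylRadius x ^ 2 * (5 - ε * ‖x‖ ^ 2)| ≤
      4 * ε * cylRadius x ^ 2 * (5 + ε * ‖x‖ ^ 2) := by
    rw [abs_mul, abs_mul, abs_neg, abs_of_nonneg (by positivity : 0 ≤ 4 * ε), abs_of_nonneg hr0]
    exact mul_le_mul_of_nonneg_left h5 (by positivity)
  refine (mul_le_mul_of_nonneg_right h1 (pow_pos hb 2).le).trans ?_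
  have h2 : ε * cylRadius x ^ 2 ≤ 1 + ε * ‖x‖ ^ 2 := by nlinarith [mul_le_mul_of_nonneg_left hr hε]
  have h3 : 5 + ε * ‖x‖ ^ 2 ≤ 5 * (1 + ε * ‖x‖ ^ 2) := by nlinarith [hb]
  calc 4 * ε * cylRadius x ^ 2 * (5 + ε * ‖x‖ ^ 2) * (1 + ε * ‖x‖ ^ 2) ^ 2
      = 4 * (ε * cylRadius x ^ 2) * (5 + ε * ‖x‖ ^ 2) * (1 + ε * ‖x‖ ^ 2) ^ 2 := by ring
    _ ≤ 4 * (1 + ε * ‖x‖ ^ 2) * (5 * (1 + ε * ‖x‖ ^ 2)) * (1 + ε * ‖x‖ ^ 2) ^ 2 := by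
        gcongr
    _ = 20 * (1 + ε * ‖x‖ ^ 2) ^ 4 := by ring

/-- **`|div (r²∇g_ε)| ≤ 20`** uniformly in `ε ≥ 0` and `x` (the dominated-convergence bound for
the diffusion term). [cite: GallaySverak2016, §6 proof of Lemma 6.4 (arXiv p. 19); formalization step] -/
theorem abs_divergence_rsq_gradient_impulseWeight_le (hε : 0 ≤ ε) (x : ℝ³) :
    |VectorCalculus.divergence (fun y : ℝ³ => (cylRadius y ^ 2) • gradient (impulseWeight ε) y) x|
      ≤ 20 :=
  (abs_divergence_rsq_gradient_impulseWeight_le_div hε x).trans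
    (div_le_self (by norm_num) (one_le_pow₀ (one_le_impulseBase hε x)))

/-- **`|div (r²∇g_ε)| ≤ 20 ε |x|²`** (the `O(ε)` form: the diffusion term vanishes pointwise as
`ε → 0`). [cite: GallaySverak2016, §6 proof of Lemma 6.4 (arXiv p. 19); formalization step] -/
theorem abs_divergence_rsq_gradient_impulseWeight_le_eps (hε : 0 ≤ ε) (x : ℝ³) :
    |VectorCalculus.divergence (fun y : ℝ³ => (cylRadius y ^ 2) • gradient (impulseWeight ε) y) x|
      ≤ 20 * ε * ‖x‖ ^ 2 := by
  rw [divergence_rsq_gradient_impulseWeight hε]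
  have hb := impulseBase_pos hε x
  have hb1 := one_le_impulseBase hε x
  have hr := cylRadius_sq_le_norm_sq x
  have hr0 := sq_nonneg (cylRadius x)
  rw [abs_div, abs_of_pos (pow_pos hb 4), div_le_iff₀ (pow_pos hb 4)]
  have h5 : |5 - ε * ‖x‖ ^ 2| ≤ 5 * (1 + ε * ‖x‖ ^ 2) :=
    (abs_sub _ _).trans (by rw [abs_of_nonneg (by norm_num : (0:ℝ) ≤ 5),
      abs_of_nonneg (by positivity)]; nlinarith [hb])
  have h1 : |-(4 * ε) * cylRadius x ^ 2 * (5 - ε * ‖x‖ ^ 2)| ≤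
      4 * ε * ‖x‖ ^ 2 * (5 * (1 + ε * ‖x‖ ^ 2)) := by
    rw [abs_mul, abs_mul, abs_neg, abs_of_nonneg (by positivity : 0 ≤ 4 * ε), abs_of_nonneg hr0]
    exact mul_le_mul (mul_le_mul_of_nonneg_left hr (by positivity)) h5 (abs_nonneg _)
      (by positivity)
  refine h1.trans ?_
  have h4 : (1 + ε * ‖x‖ ^ 2) ≤ (1 + ε * ‖x‖ ^ 2) ^ 4 := le_self_pow₀ hb1 (by norm_num)
  calc 4 * ε * ‖x‖ ^ 2 * (5 * (1 + ε * ‖x‖ ^ 2)) = 20 * ε * ‖x‖ ^ 2 * (1 + ε * ‖x‖ ^ 2) := by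
        ring
    _ ≤ 20 * ε * ‖x‖ ^ 2 * (1 + ε * ‖x‖ ^ 2) ^ 4 :=
        mul_le_mul_of_nonneg_left h4 (by positivity)

/-- **`|r² Dg_ε(x)[w]| ≤ 4 r ‖w‖`** uniformly in `ε ≥ 0` (`ε r|x| ≤ 1 + ε|x|²`): the
dominated-convergence bound for the transport term `r²Dg_ε[u] Ω`, `r|Ω| = |ω_θ|`. [cite: GallaySverak2016, §6 proof of Lemma 6.4 (arXiv p. 19); formalization step] -/
theorem abs_rsq_mul_fderiv_impulseWeight_le (hε : 0 ≤ ε) (x w : ℝ³) :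
    |cylRadius x ^ 2 * fderiv ℝ (impulseWeight ε) x w| ≤ 4 * cylRadius x * ‖w‖ := by
  rw [fderiv_impulseWeight_apply hε]
  have hb := impulseBase_pos hε x
  have hr := cylRadius_le_norm' x
  have hr0 := cylRadius_nonneg x
  have hxw : |⟪x, w⟫| ≤ ‖x‖ * ‖w‖ := abs_real_inner_le_norm x w
  rw [← mul_div_assoc, abs_div, abs_of_pos (pow_pos hb 3), div_le_iff₀ (pow_pos hb 3), abs_mul,
    abs_of_nonneg (sq_nonneg _), abs_mul, abs_neg, abs_of_nonneg (by positivity : 0 ≤ 4 * ε)]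
  have h1 : ε * cylRadius x * ‖x‖ ≤ 1 + ε * ‖x‖ ^ 2 := by
    nlinarith [mul_nonneg hε (mul_nonneg hr0 (norm_nonneg x)), mul_le_mul_of_nonneg_left hr
      (mul_nonneg hε (norm_nonneg x)), norm_nonneg x]
  have h13 : (1 + ε * ‖x‖ ^ 2) ≤ (1 + ε * ‖x‖ ^ 2) ^ 3 := le_self_pow₀ (one_le_impulseBase hε x)
    (by norm_num)
  calc cylRadius x ^ 2 * (4 * ε * |⟪x, w⟫|)
      ≤ cylRadius x ^ 2 * (4 * ε * (‖x‖ * ‖w‖)) := by gcongr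
    _ = 4 * cylRadius x * ‖w‖ * (ε * cylRadius x * ‖x‖) := by ring
    _ ≤ 4 * cylRadius x * ‖w‖ * (1 + ε * ‖x‖ ^ 2) ^ 3 :=
        mul_le_mul_of_nonneg_left (h1.trans h13) (by positivity)

/-- **`|r² Dg_ε(x)[w]| ≤ 4ε r²|x| ‖w‖`** (the `O(ε)` form). [cite: GallaySverak2016, §6 proof of Lemma 6.4 (arXiv p. 19); formalization step] -/
theorem abs_rsq_mul_fderiv_impulseWeight_le_eps (hε : 0 ≤ ε) (x w : ℝ³) :
    |cylRadius x ^ 2 * fderiv ℝ (impulseWeight ε) x w| ≤ 4 * ε * cylRadius x ^ 2 * ‖x‖ * ‖w‖ := by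
  rw [fderiv_impulseWeight_apply hε]
  have hb := impulseBase_pos hε x
  have hxw : |⟪x, w⟫| ≤ ‖x‖ * ‖w‖ := abs_real_inner_le_norm x w
  rw [← mul_div_assoc, abs_div, abs_of_pos (pow_pos hb 3)]
  refine div_le_of_le_mul₀ (pow_pos hb 3).le (by positivity) ?_
  rw [abs_mul, abs_of_nonneg (sq_nonneg _), abs_mul, abs_neg,
    abs_of_nonneg (by positivity : 0 ≤ 4 * ε)]
  have h13 : (1 : ℝ) ≤ (1 + ε * ‖x‖ ^ 2) ^ 3 := one_le_pow₀ (one_le_impulseBase hε x)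
  calc cylRadius x ^ 2 * (4 * ε * |⟪x, w⟫|) ≤ cylRadius x ^ 2 * (4 * ε * (‖x‖ * ‖w‖)) := by gcongr
    _ = 4 * ε * cylRadius x ^ 2 * ‖x‖ * ‖w‖ * 1 := by ring
    _ ≤ 4 * ε * cylRadius x ^ 2 * ‖x‖ * ‖w‖ * (1 + ε * ‖x‖ ^ 2) ^ 3 :=
        mul_le_mul_of_nonneg_left h13 (by positivity)

/-- `r²g_ε ≤ r²`: the monotone and dominated convergence bound for the weighted functional
itself. [cite: GallaySverak2016, §6 proof of Lemma 6.4 (arXiv p. 19); formalization step] -/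
theorem rsq_mul_impulseWeight_le (hε : 0 ≤ ε) (x : ℝ³) :
    cylRadius x ^ 2 * impulseWeight ε x ≤ cylRadius x ^ 2 :=
  mul_le_of_le_one_right (sq_nonneg _) (impulseWeight_le_one hε x)

end Bounds

/-! ### Square integrability for `ε > 0` -/

section L2

variable {ε : ℝ}

/-- A continuous function dominated by `C/(1 + |x|²)` is in `L²(ℝ³)` (`(1 + |x|²)⁻² ∈ L¹(ℝ³)`,
Mathlib's `integrable_rpow_neg_one_add_norm_sq` with `r = 4 > 3`). [cite: GallaySverak2016, §6 proof of Lemma 6.4 (arXiv p. 19); formalization step] -/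
theorem memLp_two_of_abs_le_div_one_add_norm_sq {f : ℝ³ → ℝ} (hf : Continuous f) {C : ℝ}
    (hle : ∀ x, |f x| ≤ C / (1 + ‖x‖ ^ 2)) : MemLp f 2 volume := by
  have h4 : (Module.finrank ℝ ℝ³ : ℝ) < 4 := by
    rw [finrank_euclideanSpace_fin]; norm_num
  have hI : Integrable (fun x : ℝ³ => (C / (1 + ‖x‖ ^ 2)) ^ 2) := by
    refine ((integrable_rpow_neg_one_add_norm_sq (μ := (volume : Measure ℝ³)) h4).const_mul
      (C ^ 2)).congr (ae_of_all _ fun x => ?_)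
    have hb : 0 < 1 + ‖x‖ ^ 2 := by positivity
    show C ^ 2 * (1 + ‖x‖ ^ 2) ^ (-4 / 2 : ℝ) = (C / (1 + ‖x‖ ^ 2)) ^ 2
    rw [div_pow, show (-4 / 2 : ℝ) = -2 by norm_num, Real.rpow_neg hb.le, Real.rpow_two,
      div_eq_mul_inv]
  have hg : MemLp (fun x : ℝ³ => C / (1 + ‖x‖ ^ 2)) 2 volume := by
    refine (memLp_two_iff_integrable_sq ?_).2 hI
    exact (continuous_const.div (by fun_prop) fun x => (by positivity : (0:ℝ) < 1 + ‖x‖ ^ 2).ne')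
      |>.aestronglyMeasurable
  refine hg.of_le hf.aestronglyMeasurable (ae_of_all _ fun x => ?_)
  rw [Real.norm_eq_abs, Real.norm_eq_abs]
  exact (hle x).trans (le_abs_self _)

/-- `1/(1 + ε|x|²) ≤ max 1 ε⁻¹ / (1 + |x|²)` for `ε > 0`. [cite: GallaySverak2016, §6 proof of Lemma 6.4 (arXiv p. 19); formalization step] -/
theorem one_div_impulseBase_le (hε : 0 < ε) (x : ℝ³) :
    1 / (1 + ε * ‖x‖ ^ 2) ≤ max 1 ε⁻¹ / (1 + ‖x‖ ^ 2) := by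
  have hb := impulseBase_pos hε.le x
  have hb' : (0 : ℝ) < 1 + ‖x‖ ^ 2 := by positivity
  rw [div_le_div_iff₀ hb hb', one_mul]
  have h1 : (1 : ℝ) ≤ max 1 ε⁻¹ := le_max_left _ _
  have h2 : ‖x‖ ^ 2 ≤ max 1 ε⁻¹ * (ε * ‖x‖ ^ 2) := by
    calc ‖x‖ ^ 2 = ε⁻¹ * (ε * ‖x‖ ^ 2) := by field_simp
      _ ≤ max 1 ε⁻¹ * (ε * ‖x‖ ^ 2) :=
          mul_le_mul_of_nonneg_right (le_max_right _ _) (by positivity)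
  nlinarith

/-- `|x|² ≤ ε⁻¹ (1 + ε|x|²)` for `ε > 0`. [folklore] -/
private theorem norm_sq_le_inv_mul_base (hε : 0 < ε) (x : ℝ³) :
    ‖x‖ ^ 2 ≤ ε⁻¹ * (1 + ε * ‖x‖ ^ 2) := by
  rw [mul_add, mul_one, ← mul_assoc, inv_mul_cancel₀ hε.ne', one_mul]
  linarith [inv_pos.2 hε]

/-- **`r² g_ε ∈ L²(ℝ³)`** for `ε > 0`. [cite: GallaySverak2016, §6 proof of Lemma 6.4 (arXiv p. 19); formalization step] -/
theorem memLp_rsq_mul_impulseWeight (hε : 0 < ε) :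
    MemLp (fun x : ℝ³ => cylRadius x ^ 2 * impulseWeight ε x) 2 volume := by
  refine memLp_two_of_abs_le_div_one_add_norm_sq
    ((continuous_cylRadius.pow 2).mul (continuous_impulseWeight hε.le)) (C := ε⁻¹ * max 1 ε⁻¹)
    fun x => ?_
  have hb := impulseBase_pos hε.le x
  have hb0 := hb.ne'
  rw [abs_of_nonneg (mul_nonneg (sq_nonneg _) (impulseWeight_pos hε.le x).le), impulseWeight]
  have hx2 : cylRadius x ^ 2 ≤ ε⁻¹ * (1 + ε * ‖x‖ ^ 2) :=
    (cylRadius_sq_le_norm_sq x).trans (norm_sq_le_inv_mul_base hε x)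
  calc cylRadius x ^ 2 * (1 / (1 + ε * ‖x‖ ^ 2) ^ 2)
      ≤ ε⁻¹ * (1 + ε * ‖x‖ ^ 2) * (1 / (1 + ε * ‖x‖ ^ 2) ^ 2) :=
        mul_le_mul_of_nonneg_right hx2 (by positivity)
    _ = ε⁻¹ * (1 / (1 + ε * ‖x‖ ^ 2)) := by field_simp
    _ ≤ ε⁻¹ * (max 1 ε⁻¹ / (1 + ‖x‖ ^ 2)) :=
        mul_le_mul_of_nonneg_left (one_div_impulseBase_le hε x) (inv_pos.2 hε).le
    _ = ε⁻¹ * max 1 ε⁻¹ / (1 + ‖x‖ ^ 2) := by ring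

/-- **`xᵢ g_ε ∈ L²(ℝ³)`** for `ε > 0`. [cite: GallaySverak2016, §6 proof of Lemma 6.4 (arXiv p. 19); formalization step] -/
theorem memLp_coord_mul_impulseWeight (hε : 0 < ε) (i : Fin 3) :
    MemLp (fun x : ℝ³ => x i * impulseWeight ε x) 2 volume := by
  have hci : Continuous fun x : ℝ³ => x i := (EuclideanSpace.proj i).continuous
  refine memLp_two_of_abs_le_div_one_add_norm_sq (hci.mul (continuous_impulseWeight hε.le))
    (C := max 1 ε⁻¹ ^ 2) fun x => ?_
  have hb := impulseBase_pos hε.le x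
  have hb' : (0 : ℝ) < 1 + ‖x‖ ^ 2 := by positivity
  have hxi : |x i| ≤ ‖x‖ := (Real.norm_eq_abs _).symm.le.trans (PiLp.norm_apply_le x i)
  have hx1 : ‖x‖ ≤ 1 + ‖x‖ ^ 2 := by nlinarith [norm_nonneg x, sq_nonneg (‖x‖ - 1)]
  have hinv := one_div_impulseBase_le hε x
  have hK2 : (1 / (1 + ε * ‖x‖ ^ 2)) ^ 2 ≤ (max 1 ε⁻¹ / (1 + ‖x‖ ^ 2)) ^ 2 :=
    pow_le_pow_left₀ (by positivity) hinv 2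
  rw [abs_mul, abs_of_pos (impulseWeight_pos hε.le x), impulseWeight, ← one_div_pow]
  calc |x i| * (1 / (1 + ε * ‖x‖ ^ 2)) ^ 2
      ≤ (1 + ‖x‖ ^ 2) * (max 1 ε⁻¹ / (1 + ‖x‖ ^ 2)) ^ 2 :=
        mul_le_mul (hxi.trans hx1) hK2 (by positivity) (by positivity)
    _ = max 1 ε⁻¹ ^ 2 / (1 + ‖x‖ ^ 2) := by field_simp

/-- `|x|³ ≤ (1 + |x|²)²`. [folklore] -/
private theorem norm_cube_le (x : ℝ³) : ‖x‖ ^ 2 * ‖x‖ ≤ (1 + ‖x‖ ^ 2) ^ 2 := by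
  have h0 := norm_nonneg x
  have h1 : 0 ≤ ‖x‖ ^ 2 * ((‖x‖ - 1 / 2) ^ 2 + 3 / 4) := by positivity
  nlinarith [h1, sq_nonneg ‖x‖]

/-- **`r² ∂ᵢg_ε ∈ L²(ℝ³)`** for `ε > 0`. [cite: GallaySverak2016, §6 proof of Lemma 6.4 (arXiv p. 19); formalization step] -/
theorem memLp_rsq_mul_fderiv_impulseWeight (hε : 0 < ε) (i : Fin 3) :
    MemLp (fun x : ℝ³ => cylRadius x ^ 2 * fderiv ℝ (impulseWeight ε) x (EuclideanSpace.single i 1))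
      2 volume := by
  have hcont : Continuous fun x : ℝ³ =>
      cylRadius x ^ 2 * fderiv ℝ (impulseWeight ε) x (EuclideanSpace.single i 1) :=
    (continuous_cylRadius.pow 2).mul
      (((contDiff_impulseWeight hε.le (n := 1)).continuous_fderiv one_ne_zero).clm_apply
        continuous_const)
  refine memLp_two_of_abs_le_div_one_add_norm_sq hcont
    (C := 4 * ε * max 1 ε⁻¹ ^ 3) fun x => ?_
  set e : ℝ³ := EuclideanSpace.single i (1 : ℝ) with he_def
  set K : ℝ := max 1 ε⁻¹ with hK_def
  have hb := impulseBase_pos hε.le x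
  have hb' : (0 : ℝ) < 1 + ‖x‖ ^ 2 := by positivity
  have hinv := one_div_impulseBase_le hε x
  have he : ‖e‖ = 1 := by simp [he_def]
  have hxe : |⟪x, e⟫| ≤ ‖x‖ := by simpa [he] using abs_real_inner_le_norm x e
  have hr := cylRadius_sq_le_norm_sq x
  have hK3 : (1 / (1 + ε * ‖x‖ ^ 2)) ^ 3 ≤ (K / (1 + ‖x‖ ^ 2)) ^ 3 :=
    pow_le_pow_left₀ (by positivity) hinv 3
  rw [fderiv_impulseWeight_apply hε.le]
  have eq1 : |cylRadius x ^ 2 * (-(4 * ε) * ⟪x, e⟫ / (1 + ε * ‖x‖ ^ 2) ^ 3)| =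
      4 * ε * (cylRadius x ^ 2 * |⟪x, e⟫|) * (1 / (1 + ε * ‖x‖ ^ 2)) ^ 3 := by
    rw [abs_mul, abs_of_nonneg (sq_nonneg _), abs_div, abs_of_pos (pow_pos hb 3), abs_mul, abs_neg,
      abs_of_nonneg (by positivity : 0 ≤ 4 * ε), one_div_pow]
    field_simp
  rw [eq1]
  calc 4 * ε * (cylRadius x ^ 2 * |⟪x, e⟫|) * (1 / (1 + ε * ‖x‖ ^ 2)) ^ 3
      ≤ 4 * ε * (‖x‖ ^ 2 * ‖x‖) * (K / (1 + ‖x‖ ^ 2)) ^ 3 :=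
        mul_le_mul (mul_le_mul_of_nonneg_left (mul_le_mul hr hxe (abs_nonneg _) (by positivity))
          (by positivity)) hK3 (by positivity) (by positivity)
    _ = 4 * ε * K ^ 3 * (‖x‖ ^ 2 * ‖x‖) / (1 + ‖x‖ ^ 2) ^ 3 := by rw [div_pow]; ring
    _ ≤ 4 * ε * K ^ 3 * (1 + ‖x‖ ^ 2) ^ 2 / (1 + ‖x‖ ^ 2) ^ 3 :=
        div_le_div_of_nonneg_right (mul_le_mul_of_nonneg_left (norm_cube_le x) (by positivity))
          (by positivity)
    _ = 4 * ε * K ^ 3 / (1 + ‖x‖ ^ 2) := by field_simp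

/-- **`div (r²∇g_ε) ∈ L²(ℝ³)`** for `ε > 0`. [cite: GallaySverak2016, §6 proof of Lemma 6.4 (arXiv p. 19); formalization step] -/
theorem memLp_divergence_rsq_gradient_impulseWeight (hε : 0 < ε) :
    MemLp (fun x => VectorCalculus.divergence
      (fun y : ℝ³ => (cylRadius y ^ 2) • gradient (impulseWeight ε) y) x) 2 volume := by
  refine memLp_two_of_abs_le_div_one_add_norm_sq
    (continuous_divergence_rsq_gradient_impulseWeight hε.le) (C := 20 * max 1 ε⁻¹ ^ 2) fun x => ?_
  have hb := impulseBase_pos hε.le x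
  have hb' : (0 : ℝ) < 1 + ‖x‖ ^ 2 := by positivity
  have hinv := one_div_impulseBase_le hε x
  have hK2 : (1 / (1 + ε * ‖x‖ ^ 2)) ^ 2 ≤ (max 1 ε⁻¹ / (1 + ‖x‖ ^ 2)) ^ 2 :=
    pow_le_pow_left₀ (by positivity) hinv 2
  have hsq : (1 + ‖x‖ ^ 2) ≤ (1 + ‖x‖ ^ 2) ^ 2 := by nlinarith [sq_nonneg ‖x‖]
  refine (abs_divergence_rsq_gradient_impulseWeight_le_div hε.le x).trans ?_
  calc 20 / (1 + ε * ‖x‖ ^ 2) ^ 2 = 20 * (1 / (1 + ε * ‖x‖ ^ 2)) ^ 2 := by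
        rw [one_div_pow, mul_one_div]
    _ ≤ 20 * (max 1 ε⁻¹ / (1 + ‖x‖ ^ 2)) ^ 2 := mul_le_mul_of_nonneg_left hK2 (by norm_num)
    _ = 20 * max 1 ε⁻¹ ^ 2 / (1 + ‖x‖ ^ 2) ^ 2 := by rw [div_pow]; ring
    _ ≤ 20 * max 1 ε⁻¹ ^ 2 / (1 + ‖x‖ ^ 2) := div_le_div_of_nonneg_left (by positivity) hb' hsq

/-- **The squared `L²` norm of the weight `r²g_ε` is finite** (the form consumed by
`IsTaoSolutionOn.integral_weight_mul_angVortQuot_eq_add`). [cite: GallaySverak2016, §6 proof of Lemma 6.4 (arXiv p. 19); formalization step] -/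
theorem lintegral_rsq_mul_impulseWeight_sq_lt_top (hε : 0 < ε) :
    ∫⁻ x : ℝ³, ‖cylRadius x ^ 2 * impulseWeight ε x‖ₑ ^ 2 < ⊤ := by
  have h := lintegral_rpow_enorm_lt_top_of_eLpNorm_lt_top two_ne_zero ENNReal.ofNat_ne_top
    (memLp_rsq_mul_impulseWeight hε).eLpNorm_lt_top
  simp only [ENNReal.toReal_ofNat] at h
  refine lt_of_le_of_lt (le_of_eq (lintegral_congr fun x => ?_)) h
  rw [← ENNReal.rpow_natCast]
  norm_num

end L2

end Literature.Analysis.FluidPDE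

end
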